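import Mathlib
import Summits.NavierStokesRegularity.NavierStokesRegularity.Theorems.FilamentSkeletonRssAreaLawSlavingHoloAreaLaw
import Summits.NavierStokesRegularity.NavierStokesRegularity.Theorems.FilamentSkeletonRssAreaLawSlavingHoloSlipZeros
import Summits.NavierStokesRegularity.NavierStokesRegularity.Theorems.FilamentSkeletonRssAreaLawSlavingHoloSlipZerosNear
import Summits.NavierStokesRegularity.NavierStokesRegularity.Theorems.FilamentSkeletonRssAreaLawSlavingHoloStadiumArea
import Summits.NavierStokesRegularity.NavierStokesRegularity.Theorems.FilamentSkeletonRssAreaLawSlavingTraceUnique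

/-!
# Area-law slaving, complex part 9 — `StadiumAnalyticArea` OF THE SLAVED AREA, FROM THE SLIP ALONE
# (`FilamentSkeletonRss`, child crux `TangentSkeletonNearStraight`, stmt-NavierStokesRegularity-28295, line
# `child_tangent_analytic_strip`, ∃-side of the registered stub `stub_analyticClosing`: the `StadiumAnalyticArea` conjunct)

The capstone of the complex parts 1–8 and the real parts 11–13: on the thin stadium `S = {z | |Im z| < hs ∧ |Re z − cc| < L + hs}` of
the line, let the slip `w` be holomorphic and real on the real trace, with its zero at the real point `c`, `Re w′(c) > 3/2`,
`‖w″‖ ≤ K₂`, `‖w′‖ ≤ M`, and a real floor `‖w x‖ ≥ μ₀` at real feet with `|x − c| > r₁`; let `A` be ANY differentiable solution of the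
REAL area law `Re w·A′ = (3/2 − (Re w)′)·A + 4` on the trace with `A ≥ Amin > 0` (in the crux: the slaved core area of
`Theorems.AreaLawSlaving.areaLaw_regular_solution_exists`).  If `K₂(r₁ + hs) ≤ 1/4` (near rectangle inside `S`) and
`(18 + 12M + 48/Amin)·hs ≤ μ₀`, then `A` IS STADIUM-ANALYTIC: `StadiumAnalyticArea hs L cc A` holds (unfolded) — the witness is the
holomorphic regular solution `G` of complex part 4, which is zero-free-input-fed by the same floors (parts 5, 5b), identified with `A`
on the trace by part 13, and windowed by part 8.

* `deriv_im_eq_zero_of_trace_real` — a holomorphic function real on the real trace has real derivative at real points;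
* `slip_ne_zero_on_stadium` — zero-freeness of the slip off `c` on `S` from the two floors;
* `stadium_analytic_area_of_slip` — the theorem.

What this leaves inside `stub_analyticClosing` for the conjunct: only producing, along the Newton scheme, a slip with these bounds on a
stadium of half-width `cs√Γ` (the scheme's own invariant, `StripPropagation` + Cauchy estimates).

HONEST FRAMING: classical analysis serving a HYPOTHETICAL filament skeleton on the NEGATIVE side of a MODEL route; no registered stub is
closed by this file and nothing here bears on Navier–Stokes regularity or blow-up.  `--supports stmt-NavierStokesRegularity-28295`.
-/

set_option linter.dupNamespace false

noncomputable section

namespace Summit.NavierStokesRegularity.NavierStokesRegularity.Theorems.AreaLawSlavingHolo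

open Set Metric Filter Real
open scoped Topology

/-! ## §1 Two small facts about the slip on the stadium -/

/-- A holomorphic function on an open set, real on the real trace, has real derivative at every real point of the set. [folklore] -/
theorem deriv_im_eq_zero_of_trace_real {U : Set ℂ} (hUo : IsOpen U) {w : ℂ → ℂ} (hw : DifferentiableOn ℂ w U)
    (hw_re : ∀ x : ℝ, (x : ℂ) ∈ U → (w x).im = 0) {c : ℝ} (hc : (c : ℂ) ∈ U) : (deriv w c).im = 0 := by
  -- `Im w = Re(−I·w)`; differentiate the real trace of the holomorphic function `−I·w`
  have h1 : HasDerivAt (fun z : ℂ => -Complex.I * w z) (-Complex.I * deriv w c) (c : ℂ) :=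
    ((hw.differentiableAt (hUo.mem_nhds hc)).hasDerivAt).const_mul (-Complex.I)
  have h2 : HasDerivAt (fun x : ℝ => ((fun z : ℂ => -Complex.I * w z) (x : ℂ)).re) (-Complex.I * deriv w c).re c :=
    h1.real_of_complex
  have hre : (-Complex.I * deriv w c).re = (deriv w c).im := by simp [Complex.mul_re]
  have hT : {x : ℝ | (x : ℂ) ∈ U} ∈ 𝓝 c :=
    (hUo.preimage Complex.continuous_ofReal).mem_nhds hc
  have h3 : HasDerivAt (fun x : ℝ => ((fun z : ℂ => -Complex.I * w z) (x : ℂ)).re) 0 c := by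
    refine (hasDerivAt_const c (0 : ℝ)).congr_of_eventuallyEq ?_
    exact Filter.eventually_of_mem hT (fun x hx => by simp [Complex.mul_re, hw_re x hx])
  have := h2.unique h3
  rwa [hre] at this

/-- **Zero-freeness of the slip off its zero on the thin stadium** from the two floors: the non-degeneracy disc
(`ne_zero_near_of_second_deriv_le`, radius `r₁ + hs`, `K₂(r₁ + hs) ≤ 1/4 < 3/2 < ‖w′(c)‖`) on the near rectangle and the real floor
(`ne_zero_of_real_floor`, `M·hs < μ₀`) beyond it. [folklore] -/
theorem slip_ne_zero_on_stadium {hs L cc c r₁ K₂ M μ₀ : ℝ} {U : Set ℂ}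
    (hU : U = {z : ℂ | |z.im| < hs ∧ |z.re - cc| < L + hs})
    {w : ℂ → ℂ} (hw : DifferentiableOn ℂ w U) (hcU : (c : ℂ) ∈ U) (hwc : w c = 0) (hwc_re : 3 / 2 < (deriv w c).re)
    (hK₂ : ∀ ζ ∈ U, ‖deriv (deriv w) ζ‖ ≤ K₂) (hK₂r : K₂ * (r₁ + hs) ≤ 1 / 4)
    (hM : ∀ ζ ∈ U, ‖deriv w ζ‖ ≤ M)
    (hfloor : ∀ x : ℝ, (x : ℂ) ∈ U → r₁ < |x - c| → μ₀ ≤ ‖w x‖) (hMhs : M * hs < μ₀) :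
    ∀ z ∈ U, z ≠ c → w z ≠ 0 := by
  have hUo : IsOpen U := by rw [hU]; exact thinStadium_isOpen hs L cc
  have hUc : Convex ℝ U := by
    rw [hU]; exact Summit.NavierStokesRegularity.NavierStokesRegularity.Theorems.StadiumBaseMargin.stadium_convex hs L cc
  have hmemU : ∀ z : ℂ, z ∈ U ↔ |z.im| < hs ∧ |z.re - cc| < L + hs := by
    intro z; rw [hU]; rfl
  intro z hz hzc
  have hz' := (hmemU z).1 hz
  have hhs : 0 < hs := lt_of_le_of_lt (abs_nonneg _) hz'.1
  rcases le_or_gt |z.re - c| r₁ with hle | hlt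
  · -- near: the non-degeneracy disc of radius `r₁ + hs`
    have hd : ‖z - (c : ℂ)‖ < r₁ + hs := by
      have h := Complex.norm_le_abs_re_add_abs_im (z - (c : ℂ))
      rw [Complex.sub_re, Complex.sub_im, Complex.ofReal_re, Complex.ofReal_im, sub_zero] at h
      linarith [hz'.1]
    have hR : K₂ * (r₁ + hs) < ‖deriv w (c : ℂ)‖ :=
      lt_of_le_of_lt hK₂r (by linarith [Complex.abs_re_le_norm (deriv w (c : ℂ)), le_abs_self (deriv w (c : ℂ)).re])
    exact ne_zero_near_of_second_deriv_le hUo hUc hw hK₂ hcU hwc hR hz hzc hd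
  · -- far: the real floor
    have hfoot : ((z.re : ℝ) : ℂ) ∈ U := by rw [hU] at hz ⊢; exact thinStadium_foot hz
    have hMnn : 0 ≤ M := le_trans (norm_nonneg _) (hM z hz)
    have hthin : M * |z.im| < μ₀ := lt_of_le_of_lt (mul_le_mul_of_nonneg_left hz'.1.le hMnn) hMhs
    exact ne_zero_of_real_floor hUo hUc hw hM hz hfoot (hfloor z.re hfoot hlt) hthin

/-! ## §2 The capstone -/

/-- **`StadiumAnalyticArea` of the slaved area from the slip alone.**  See the module docstring.  The conclusion is the
`StadiumAnalyticArea hs L cc A` conjunct of `TangentSkeletonAnalytic` (line `child_tangent_analytic_strip` §2), `Stadium` unfolded.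
[folklore] -/
theorem stadium_analytic_area_of_slip {hs L cc c r₁ K₂ M μ₀ Amin : ℝ} {U : Set ℂ}
    (hU : U = {z : ℂ | |z.im| < hs ∧ |z.re - cc| < L + hs}) (hr₁ : 0 ≤ r₁) (hrect : |c - cc| + r₁ < L + hs)
    {w : ℂ → ℂ} (hw : DifferentiableOn ℂ w U) (hw_re : ∀ x : ℝ, (x : ℂ) ∈ U → (w x).im = 0)
    (hwc : w c = 0) (hwc_re : 3 / 2 < (deriv w c).re)
    (hK₂ : ∀ ζ ∈ U, ‖deriv (deriv w) ζ‖ ≤ K₂) (hK₂r : K₂ * (r₁ + hs) ≤ 1 / 4)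
    (hM : ∀ ζ ∈ U, ‖deriv w ζ‖ ≤ M) (hμ₀ : 0 < μ₀)
    (hfloor : ∀ x : ℝ, (x : ℂ) ∈ U → r₁ < |x - c| → μ₀ ≤ ‖w x‖)
    {A : ℝ → ℝ} (hAd : ∀ x : ℝ, (x : ℂ) ∈ U → DifferentiableAt ℝ A x)
    (hAeq : ∀ x : ℝ, (x : ℂ) ∈ U → (w x).re * deriv A x = (3 / 2 - deriv (fun t : ℝ => (w t).re) x) * A x + 4)
    (hAmin : 0 < Amin) (hA : ∀ x : ℝ, (x : ℂ) ∈ U → Amin ≤ A x) (hthin : (18 + 12 * M + 48 / Amin) * hs ≤ μ₀) :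
    ∃ G : ℂ → ℂ, DifferentiableOn ℂ G {z : ℂ | |z.im| < hs ∧ |z.re - cc| < L + hs} ∧
      (∀ t : ℝ, (t : ℂ) ∈ {z : ℂ | |z.im| < hs ∧ |z.re - cc| < L + hs} → G t = ((A t : ℝ) : ℂ)) ∧
      ∀ z ∈ {z : ℂ | |z.im| < hs ∧ |z.re - cc| < L + hs}, A z.re / 2 ≤ (G z).re ∧ ‖G z‖ ≤ 2 * A z.re := by
  have hUo : IsOpen U := by rw [hU]; exact thinStadium_isOpen hs L cc
  have hUc : Convex ℝ U := by
    rw [hU]; exact Summit.NavierStokesRegularity.NavierStokesRegularity.Theorems.StadiumBaseMargin.stadium_convex hs L cc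
  have hmemU : ∀ z : ℂ, z ∈ U ↔ |z.im| < hs ∧ |z.re - cc| < L + hs := by
    intro z; rw [hU]; rfl
  -- the empty stadium
  by_cases hhs : 0 < hs
  swap
  · refine ⟨fun _ => 0, ?_, ?_, ?_⟩
    · intro z hz; exact absurd (lt_of_le_of_lt (abs_nonneg _) hz.1) hhs
    · intro t ht; exact absurd (lt_of_le_of_lt (abs_nonneg _) ht.1) hhs
    · intro z hz; exact absurd (lt_of_le_of_lt (abs_nonneg _) hz.1) hhs
  -- the inhabited stadium: `↑c ∈ U`, real trace = `(cc − (L + hs), cc + (L + hs))`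
  have hcc : |c - cc| < L + hs := by linarith
  have htraceIff : ∀ x : ℝ, (x : ℂ) ∈ U ↔ x ∈ Ioo (cc - (L + hs)) (cc + (L + hs)) := by
    intro x
    rw [hmemU]
    simp only [Complex.ofReal_im, abs_zero, Complex.ofReal_re, mem_Ioo, abs_lt]
    constructor
    · rintro ⟨-, h1, h2⟩; constructor <;> linarith
    · rintro ⟨h1, h2⟩; exact ⟨hhs, by linarith, by linarith⟩
  have hcU : (c : ℂ) ∈ U := by rw [hmemU]; exact ⟨by simpa using hhs, by simpa using hcc⟩
  have hK₂nn : 0 ≤ K₂ := le_trans (norm_nonneg _) (hK₂ c hcU)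
  have hMnn : 0 ≤ M := le_trans (norm_nonneg _) (hM c hcU)
  have hMhs : M * hs < μ₀ := by
    have h48 : 0 ≤ 48 / Amin * hs := by positivity
    nlinarith [hthin, hhs]
  -- the derivative at the zero is real
  have hwc_im : (deriv w c).im = 0 := deriv_im_eq_zero_of_trace_real hUo hw hw_re hcU
  -- zero-freeness off `c`
  have hwz : ∀ z ∈ U, z ≠ c → w z ≠ 0 := slip_ne_zero_on_stadium hU hw hcU hwc hwc_re hK₂ hK₂r hM hfloor hMhs
  -- the holomorphic regular solution (complex part 4)
  obtain ⟨G, hG, hG_re, hode, hGc, htrlaw⟩ := areaLaw_holo hUo hUc hcU hw hw_re hwc hwc_re hwz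
  -- identification of the real trace with `A` (real part 13)
  have hw'at : ∀ x : ℝ, (x : ℂ) ∈ U → HasDerivAt (fun t : ℝ => (w t).re) (deriv w x).re x := fun x hx =>
    ((hw.differentiableAt (hUo.mem_nhds hx)).hasDerivAt).real_of_complex
  have hident : ∀ x : ℝ, (x : ℂ) ∈ U → (G x).re = A x := by
    intro x hx
    have hcI : c ∈ Ioo (cc - (L + hs)) (cc + (L + hs)) := (htraceIff c).1 hcU
    refine Summit.NavierStokesRegularity.NavierStokesRegularity.Theorems.AreaLawSlaving.areaLaw_trace_unique
      (w := fun t : ℝ => (w t).re) (A₁ := fun t : ℝ => (G t).re) (A₂ := A) (d := (deriv w c).re) (K₂ := K₂) (Λ := M) hcI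
      (fun s hs' => (hw'at s ((htraceIff s).2 hs')).differentiableAt)
      (fun s hs' => (htrlaw s ((htraceIff s).2 hs')).1.differentiableAt)
      (fun s hs' => hAd s ((htraceIff s).2 hs'))
      (fun s hs' => (htrlaw s ((htraceIff s).2 hs')).2)
      (fun s hs' => hAeq s ((htraceIff s).2 hs'))
      (by show (w c).re = 0; rw [hwc]; simp)
      (fun s hs' hsc => ?_) hwc_re hK₂nn (fun s hs' => ?_) (fun s hs' => ?_) ((htraceIff x).1 hx)
    · -- `Re w s ≠ 0` off `c`
      have hsU := (htraceIff s).2 hs'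
      have hne : w s ≠ 0 := hwz s hsU (fun h => hsc (by exact_mod_cast h))
      intro h
      apply hne
      apply Complex.ext
      · simpa using h
      · simpa using hw_re s hsU
    · -- `|(Re w)′ s − d| ≤ K₂ |s − c|`
      have hsU := (htraceIff s).2 hs'
      rw [(hw'at s hsU).deriv]
      have h := deriv_sub_le_of_second_deriv_le hUo hUc hw hK₂ hsU hcU
      calc |(deriv w (s : ℂ)).re - (deriv w (c : ℂ)).re| = |(deriv w (s : ℂ) - deriv w (c : ℂ)).re| := by
            rw [Complex.sub_re]
        _ ≤ ‖deriv w (s : ℂ) - deriv w (c : ℂ)‖ := Complex.abs_re_le_norm _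
        _ ≤ K₂ * ‖(s : ℂ) - (c : ℂ)‖ := h
        _ = K₂ * |s - c| := by rw [← Complex.ofReal_sub, Complex.norm_real, Real.norm_eq_abs]
    · -- `|(Re w)′ s| ≤ M`
      have hsU := (htraceIff s).2 hs'
      rw [(hw'at s hsU).deriv]
      exact (Complex.abs_re_le_norm _).trans (hM _ hsU)
  have htrace : ∀ x : ℝ, (x : ℂ) ∈ U → G x = ((A x : ℝ) : ℂ) := by
    intro x hx
    apply Complex.ext
    · simpa using hident x hx
    · simpa using hG_re x hx
  -- the window (complex part 8)
  exact stadium_area_window hU hr₁ hrect hw hG hode hwc hwc_im hwc_re hGc hK₂ hK₂r hM hμ₀ hfloor htrace hAmin hA hthin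

end Summit.NavierStokesRegularity.NavierStokesRegularity.Theorems.AreaLawSlavingHolo
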